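import Summits.Ventures.HodgeRepro.TwistSymmetric
import Summits.Ventures.HodgeRepro.CMTypeCount

/-!
# The number of type squares: `C(m,2)·2^(m−2)` for every finite `(G, c)` (seat `p1`, gen 5)

Blind re-derivation cell `pub-hodge-repro`.  Continues `TwistSymmetric.lean` and `CMTypeCount.lean`.  Lemma 1 of
`proofs/P1.md` §8: a type square is the same thing as an unordered pair of places together with a partial CM type
on the remaining places, so with `|G| = 2m` there are `C(m,2)·2^(m−2)` squares — `6, 24, 240` at `m = 3, 4, 6`,
the sealed census's `squares.length`.  Here the count is obtained by double counting the faces: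

* `placePairs c` — ordered pairs of embeddings at distinct places (`card_placePairs`: `2m·(2m − 2)`);
* `faceData c` — the faces `(Φ; p, p')`: a CM type and such a pair (`card_faceData`: `2^m · 2m · (2m − 2)`);
* `squares c` — the type squares, the image of `faceData c` under `typeSquare`;
* `typeSquare_eq_iff` — two faces have the same square iff the second type is a corner of the first square and the
  two place pairs agree as unordered pairs;
* `card_fiber_typeSquare` — every square is the square of exactly `32 = 4·8` faces;
* **`card_squares_mul`** — `32·#squares = 2^m·2m·(2m − 2)`, and **`card_squares`** — `#squares = C(m,2)·2^(m−2)`;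
* `card_places` — there are `m = |G|/2` places, and `not_smul_mem_typeSquare` — given a third place, no two corners of a
  square are complex-conjugate types (the sealed rows' `noConjugateCorners`: no face class is a product of divisor classes).
-/

open Finset
open scoped Pointwise

namespace HodgeRepro.TwistOrbit

variable {G : Type*} [Group G] [DecidableEq G]

/-! ### Places and corners -/

/-- A place has exactly two elements. -/
theorem card_place {c : G} (hc : IsComplexConj c) (p : G) : (place c p).card = 2 := by
  unfold place
  exact card_pair_eq_two_iff.2 (hc.mul_ne_self p).symm

/-- Every corner of the square of a CM type is a CM type. -/
theorem isCMType_of_mem_typeSquare {c : G} (hc : IsComplexConj c) {Φ : Finset G} (hΦ : IsCMType c Φ) {p p' : G}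
    {Ψ : Finset G} (hΨ : Ψ ∈ typeSquare c Φ p p') : IsCMType c Ψ := by
  simp only [typeSquare, mem_insert, mem_singleton] at hΨ
  rcases hΨ with rfl | rfl | rfl | rfl
  · exact hΦ
  · exact hΦ.flipAt hc p
  · exact hΦ.flipAt hc p'
  · exact (hΦ.flipAt hc p).flipAt hc p'

/-! ### When do two faces have the same square? -/

/-- If the square of `(Ψ; q, q')` is the square of `(Φ; p, p')`, then `q` lies in one of the two places of the latter. -/
theorem mem_place_or_of_typeSquare_eq {c : G} {Φ Ψ : Finset G} {p p' q q' : G}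
    (h : typeSquare c Ψ q q' = typeSquare c Φ p p') : q ∈ place c p ∨ q ∈ place c p' := by
  have hΨ : Ψ ∈ typeSquare c Φ p p' := by rw [← h]; exact self_mem_typeSquare c Ψ q q'
  have hS : typeSquare c Ψ q q' = typeSquare c Ψ p p' := by rw [h, typeSquare_eq_of_mem hΨ]
  by_contra hcon
  rw [not_or] at hcon
  have hm : flipAt c q Ψ ∈ typeSquare c Ψ p p' := by rw [← hS]; exact flipAt_mem_typeSquare c Ψ q q'
  have e := mem_iff_of_mem_typeSquare hm hcon.1 hcon.2
  rw [mem_flipAt_self_iff] at e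
  exact not_iff_not_self e.symm

/-- **Two faces have the same square** iff the second type is a corner of the first square and the place pairs agree
as unordered pairs. -/
theorem typeSquare_eq_iff {c : G} (hc : IsComplexConj c) {Φ Ψ : Finset G} {p p' q q' : G}
    (hqq' : q' ∉ place c q) :
    typeSquare c Ψ q q' = typeSquare c Φ p p' ↔
      Ψ ∈ typeSquare c Φ p p' ∧ ((q ∈ place c p ∧ q' ∈ place c p') ∨ (q ∈ place c p' ∧ q' ∈ place c p)) := by
  constructor
  · intro h
    have hΨ : Ψ ∈ typeSquare c Φ p p' := by rw [← h]; exact self_mem_typeSquare c Ψ q q'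
    refine ⟨hΨ, ?_⟩
    have hq : q ∈ place c p ∨ q ∈ place c p' := mem_place_or_of_typeSquare_eq h
    have h' : typeSquare c Ψ q' q = typeSquare c Φ p p' := by rw [typeSquare_comm c Ψ q' q]; exact h
    have hq' : q' ∈ place c p ∨ q' ∈ place c p' := mem_place_or_of_typeSquare_eq h'
    rcases hq with hq | hq <;> rcases hq' with hq' | hq'
    · exfalso; apply hqq'; rw [place_eq_of_mem hc hq]; exact hq'
    · exact Or.inl ⟨hq, hq'⟩
    · exact Or.inr ⟨hq, hq'⟩
    · exfalso; apply hqq'; rw [place_eq_of_mem hc hq]; exact hq'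
  · rintro ⟨hΨ, ⟨hq, hq'⟩ | ⟨hq, hq'⟩⟩
    · rw [← typeSquare_eq_of_mem hΨ]
      have e1 : ∀ S, flipAt c q S = flipAt c p S := flipAt_congr (place_eq_of_mem hc hq)
      have e2 : ∀ S, flipAt c q' S = flipAt c p' S := flipAt_congr (place_eq_of_mem hc hq')
      simp only [typeSquare, e1, e2]
    · rw [← typeSquare_eq_of_mem hΨ, typeSquare_comm c Ψ p p']
      have e1 : ∀ S, flipAt c q S = flipAt c p' S := flipAt_congr (place_eq_of_mem hc hq)
      have e2 : ∀ S, flipAt c q' S = flipAt c p S := flipAt_congr (place_eq_of_mem hc hq')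
      simp only [typeSquare, e1, e2]

variable [Fintype G]

/-! ### Faces and squares as finsets -/

/-- Ordered pairs `(p, p')` of embeddings at distinct places (`p' ∉ {p, c p}`). -/
def placePairs (c : G) : Finset (G × G) := (univ ×ˢ univ).filter fun y => y.2 ∉ place c y.1

/-- Membership in `placePairs`. -/
theorem mem_placePairs {c : G} {y : G × G} : y ∈ placePairs c ↔ y.2 ∉ place c y.1 := by
  simp [placePairs]

/-- The faces `(Φ; p, p')`: a CM type and two embeddings at distinct places. -/
def faceData (c : G) : Finset (Finset G × G × G) := cmTypes c ×ˢ placePairs c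

/-- Membership in `faceData`. -/
theorem mem_faceData {c : G} {x : Finset G × G × G} :
    x ∈ faceData c ↔ IsCMType c x.1 ∧ x.2.2 ∉ place c x.2.1 := by
  simp [faceData, mem_cmTypes, mem_placePairs]

/-- The type squares of `(G, c)`: the squares of all faces. -/
def squares (c : G) : Finset (Finset (Finset G)) :=
  (faceData c).image fun x => typeSquare c x.1 x.2.1 x.2.2

/-- Membership in `squares`. -/
theorem mem_squares {c : G} {S : Finset (Finset G)} :
    S ∈ squares c ↔ ∃ Φ p p', IsCMType c Φ ∧ p' ∉ place c p ∧ typeSquare c Φ p p' = S := by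
  simp only [squares, mem_image, mem_faceData, Prod.exists]
  constructor
  · rintro ⟨Φ, p, p', ⟨h1, h2⟩, h3⟩
    exact ⟨Φ, p, p', h1, h2, h3⟩
  · rintro ⟨Φ, p, p', h1, h2, h3⟩
    exact ⟨Φ, p, p', ⟨h1, h2⟩, h3⟩

/-- The square of a face of a CM type is a square. -/
theorem typeSquare_mem_squares {c : G} {Φ : Finset G} (hΦ : IsCMType c Φ) {p p' : G} (hpp' : p' ∉ place c p) :
    typeSquare c Φ p p' ∈ squares c :=
  mem_squares.2 ⟨Φ, p, p', hΦ, hpp', rfl⟩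

/-- Every member of a square is a CM type. -/
theorem isCMType_of_mem_of_mem_squares {c : G} (hc : IsComplexConj c) {S : Finset (Finset G)} (hS : S ∈ squares c)
    {Ψ : Finset G} (hΨ : Ψ ∈ S) : IsCMType c Ψ := by
  obtain ⟨Φ, p, p', hΦ, -, rfl⟩ := mem_squares.1 hS
  exact isCMType_of_mem_typeSquare hc hΦ hΨ

/-! ### Counting faces -/

/-- The number of ordered pairs of embeddings at distinct places is `|G|·(|G| − 2)`. -/
theorem card_placePairs {c : G} (hc : IsComplexConj c) :
    (placePairs c).card = Fintype.card G * (Fintype.card G - 2) := by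
  unfold placePairs
  rw [card_filter, sum_product]
  have h : ∀ p : G, (∑ p' : G, if p' ∉ place c p then 1 else 0) = Fintype.card G - 2 := by
    intro p
    rw [← card_filter, filter_not, filter_mem_eq_inter, univ_inter, ← compl_eq_univ_sdiff, card_compl,
      card_place hc]
  simp only [h, sum_const, card_univ, smul_eq_mul]

/-- The number of faces is `2^m · |G| · (|G| − 2)`, `m = |G|/2`. -/
theorem card_faceData {c : G} (hc : IsComplexConj c) :
    (faceData c).card = 2 ^ (Fintype.card G / 2) * (Fintype.card G * (Fintype.card G - 2)) := by
  unfold faceData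
  rw [card_product, card_cmTypes hc, card_placePairs hc]

/-! ### The fibres of `typeSquare` have 32 elements -/

/-- The faces with a given square `typeSquare c Φ p p'`: a corner and a pair of embeddings at the two places. -/
theorem filter_faceData_typeSquare_eq {c : G} (hc : IsComplexConj c) {Φ : Finset G} (hΦ : IsCMType c Φ) {p p' : G}
    (hpp' : p' ∉ place c p) :
    ((faceData c).filter fun x => typeSquare c x.1 x.2.1 x.2.2 = typeSquare c Φ p p') =
      typeSquare c Φ p p' ×ˢ (place c p ×ˢ place c p' ∪ place c p' ×ˢ place c p) := by
  ext ⟨Ψ, q, q'⟩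
  simp only [mem_filter, mem_faceData, mem_product, mem_union]
  constructor
  · rintro ⟨⟨-, hqq'⟩, h⟩
    exact (typeSquare_eq_iff hc hqq').1 h
  · rintro ⟨hΨ, hqq⟩
    have hqq' : q' ∉ place c q := by
      rcases hqq with ⟨hq, hq'⟩ | ⟨hq, hq'⟩
      · rw [place_eq_of_mem hc hq]; exact disjoint_right.1 (disjoint_place hc hpp') hq'
      · rw [place_eq_of_mem hc hq]; exact not_mem_place_of_mem_place hc hpp' hq'
    exact ⟨⟨isCMType_of_mem_typeSquare hc hΦ hΨ, hqq'⟩, (typeSquare_eq_iff hc hqq').2 ⟨hΨ, hqq⟩⟩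

/-- **Every square is the square of exactly `32` faces** (four corners times eight ordered pairs of embeddings at its two
places). -/
theorem card_fiber_typeSquare {c : G} (hc : IsComplexConj c) {Φ : Finset G} (hΦ : IsCMType c Φ) {p p' : G}
    (hpp' : p' ∉ place c p) :
    ((faceData c).filter fun x => typeSquare c x.1 x.2.1 x.2.2 = typeSquare c Φ p p').card = 32 := by
  rw [filter_faceData_typeSquare_eq hc hΦ hpp', card_product, card_typeSquare hc Φ hpp']
  have hdisj : Disjoint (place c p ×ˢ place c p') (place c p' ×ˢ place c p) := by
    rw [disjoint_left]
    rintro ⟨a, b⟩ h1 h2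
    rw [mem_product] at h1 h2
    exact not_mem_place_of_mem_place hc hpp' h1.1 h2.1
  rw [card_union_of_disjoint hdisj, card_product, card_product, card_place hc, card_place hc]

/-! ### The count -/

/-- **`32·#squares = 2^m·|G|·(|G| − 2)`**, `m = |G|/2` (double counting the faces). -/
theorem card_squares_mul {c : G} (hc : IsComplexConj c) :
    32 * (squares c).card = 2 ^ (Fintype.card G / 2) * (Fintype.card G * (Fintype.card G - 2)) := by
  rw [← card_faceData hc, card_eq_sum_card_image (fun x : Finset G × G × G => typeSquare c x.1 x.2.1 x.2.2)]
  rw [sum_congr rfl (g := fun _ => 32), sum_const, smul_eq_mul, mul_comm]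
  · rfl
  intro S hS
  obtain ⟨Φ, p, p', hΦ, hpp', rfl⟩ := mem_squares.1 hS
  exact card_fiber_typeSquare hc hΦ hpp'

/-- `|G|` is even: `|G| = 2·m` with `m = |G|/2`. -/
theorem card_eq_two_mul_half {c : G} (hc : IsComplexConj c) : Fintype.card G = 2 * (Fintype.card G / 2) := by
  obtain ⟨Φ₀, hΦ₀⟩ := exists_isCMType hc
  have := hΦ₀.two_mul_card hc
  omega

/-- **The number of type squares is `C(m,2)·2^(m−2)`**, `m = |G|/2 ≥ 2` (the number of places; `6, 24, 240` at
`m = 3, 4, 6`). -/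
theorem card_squares {c : G} (hc : IsComplexConj c) (hm : 2 ≤ Fintype.card G / 2) :
    (squares c).card = (Fintype.card G / 2).choose 2 * 2 ^ (Fintype.card G / 2 - 2) := by
  have h32 := card_squares_mul hc
  have hn := card_eq_two_mul_half hc
  set m := Fintype.card G / 2 with hm_def
  obtain ⟨k, hk⟩ : ∃ k, m = k + 2 := ⟨m - 2, by omega⟩
  rw [hn] at h32
  have hpow : 2 ^ m = 4 * 2 ^ (m - 2) := by
    rw [hk, Nat.add_sub_cancel, pow_add]; norm_num; ring
  rw [hpow] at h32
  rw [Nat.choose_two_right]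
  obtain ⟨j, hj⟩ : Even (m * (m - 1)) := Nat.even_mul_pred_self m
  have hj' : m * (m - 1) / 2 = j := by omega
  rw [hj']
  have h2 : 2 * m * (2 * m - 2) = 4 * (j + j) := by
    have : 2 * m - 2 = 2 * (m - 1) := by omega
    rw [this, ← hj]; ring
  rw [h2] at h32
  have : 32 * (squares c).card = 32 * (j * 2 ^ (m - 2)) := by rw [h32]; ring
  exact Nat.eq_of_mul_eq_mul_left (by norm_num) this

/-! ### The places, and no two conjugate corners -/

/-- The places of `(G, c)`: the conjugate pairs `{p, c p}`. -/
def places (c : G) : Finset (Finset G) := univ.image (place c)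

/-- **There are `|G|/2` places**: `p ↦ {p, c p}` is a bijection from any CM type onto the places. -/
theorem card_places {c : G} (hc : IsComplexConj c) : (places c).card = Fintype.card G / 2 := by
  obtain ⟨Φ₀, hΦ₀⟩ := exists_isCMType hc
  have h2 := hΦ₀.two_mul_card hc
  have himg : Φ₀.image (place c) = places c := by
    ext π
    simp only [places, mem_image, mem_univ, true_and]
    constructor
    · rintro ⟨p, -, rfl⟩; exact ⟨p, rfl⟩
    · rintro ⟨p, rfl⟩
      obtain ⟨a, ha, hap⟩ := exists_mem_place_of_isCMType hΦ₀ p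
      exact ⟨a, ha, place_eq_of_mem hc hap⟩
  rw [← himg, card_image_of_injOn]
  · omega
  · intro p hp q hq hpq
    have hqp : q ∈ place c p := by rw [hpq]; exact mem_place_self c q
    exact (eq_of_mem_place_of_isCMType hΦ₀ hp hq hqp).symm

omit [Fintype G] in
/-- **No two corners of a square are complex-conjugate types** (given a third place): the sealed rows'
`noConjugateCorners` — a corner and the conjugate of another corner agree at the third place, but a CM type never
contains both an embedding and its conjugate. -/
theorem not_smul_mem_typeSquare {c : G} (hc : IsComplexConj c) {Φ : Finset G} (hΦ : IsCMType c Φ) {p p' : G}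
    (hq : ∃ q, q ∉ place c p ∧ q ∉ place c p') {Ψ T : Finset G} (hΨ : Ψ ∈ typeSquare c Φ p p')
    (hT : T ∈ typeSquare c Φ p p') : c • Ψ ≠ T := by
  intro h
  obtain ⟨x, hxΦ, hx1, hx2⟩ := exists_mem_outside hc hΦ hq
  have hxΨ : x ∈ Ψ := (mem_iff_of_mem_typeSquare hΨ hx1 hx2).2 hxΦ
  have hxT : x ∈ T := (mem_iff_of_mem_typeSquare hT hx1 hx2).2 hxΦ
  rw [← h, hc.mem_smul_iff] at hxT
  exact not_conj_mem_of_mem (isCMType_of_mem_typeSquare hc hΦ hΨ) hxΨ hxT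

end HodgeRepro.TwistOrbit
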